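import Literature.MathematicalPhysics.QuantumFieldTheory.Balaban1983to89.B9Eq326DeltaABlockDecayTowerTwoBackgroundsCurv
import Literature.MathematicalPhysics.QuantumFieldTheory.Balaban1983to89.B9Eq349ConjugatedQTowerLettersTwoBackgroundsCompanion

/-!
# `Balaban1983to89.B9Eq326DeltaABlockDecayTowerTwoBackgroundsCurvQ` — T. Bałaban, *Propagators for lattice gauge theories in a background field*, Commun. Math.
# Phys. **99** (1985) 389–434 [Balaban1985BackgroundPropagators] (3.26) p. 395, (3.15)–(3.16) p. 393, (3.49) p. 399, (3.101) p. 414, Thm 3.4 p. 400, (3.86)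
# p. 407, Thm 3.11 p. 416: **THE BIG-BLOCK `L²` DECAY OF `G₁,k(V) − G₁,k(U)` WITH THE CONJUGATED `Q_k` LETTERS `δ_Q` ∕ `δ_Q′` DISCHARGED TOO** — the two-background
# bundle `hT2'` of `B9Eq326DeltaABlockDecayTowerTwoBackgroundsCurv.norm_block_G1k_sub_G1k_le_lipschitz_curv` cut to its `δ_R` conjunct alone (`hTR`), the `δ_Q` ∧
# `δ_Q′` conjuncts supplied, uniformly on the circle `‖κ‖ = r`, by `B9Eq349ConjugatedQTowerLettersTwoBackgroundsCompanion.expConj_Qk_letters_twoBackgrounds` at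
# `ι := ℓη` under the two windows `r(3ℓ′ + L^{n+1}ℓη) ≤ 1`, `r·2dL^nℓη ≤ 1`, with `δ_Q := M_φ′M_φ√(c₁∕(c₀L^{(n+1)d}))·P′_{n+1}(r)·(T̃_{n+1}(r) − 1)` displayed as a
# definitional binder

statement-level skeleton of published theorems with citation tags; proofs where landed; nothing here is a claim about the Yang–Mills mass gap

PDF held: `paper:balaban1985-cmp99-background-propagators` (journal page = PDF page + 388); (3.26) p. 395, (3.15)–(3.16) p. 393, (3.49) p. 399 read through the
suppliers.

CITATION HEADER (lean-in-tree rule 2026-08-18).  Audit cell `pub-balaban`, sub-cell `t4`, NE9 crux team (2): LEAF PROVER 01 (`b2b-balaban-t4-ne9-formalise-leaf-01`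
gen 90), I-5 = the N52 road (α) END after the four-file batch «the `δ_Q` ∕ `δ_Q′` conjuncts».  WHY: after I-13 (gen 88) the block-decay constant displayed the
three CONJUGATED two-background letters `δ_R`, `δ_Q`, `δ_Q′`; gen 90's `B9Eq349ConjugatedQ{Letters,TowerLetters,TowerLettersReadings,TowerLettersCompanion}TwoBackgrounds`
prove the `Q_k` pair from the crew's landed one-step letters, so here `hT2'` shrinks to `δ_R` ((PDC)-type, non-local `R_k` — located in ne9-leaf-04 g81's
`LOCATED-deltaQ-deltaR.md`, NOT typed).  CREDIT: ne9-leaf-04 g85's located remark L-leaf04-g85-2 (journal l.65962) — the companion keeps leaf-04 g77's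
MULTIPLICATIVE windowed closeness; the bridge from I-13's ADDITIVE level closeness `hLUV` is the unitary one-liner `‖V̄Ū⁻¹ − 1‖ ≤ ‖Ū − V̄‖` done here.

WHAT IS PROVED (sorry-free; 0 `def`; [folklore] composition BY NAME; nothing of [B9] asserted as printed).
* **`norm_block_G1k_sub_G1k_le_lipschitz_curv_Q`** — I-13's theorem with the bundle reduced to `δ_R` (`hTR`), two extra windows `hwinQ0`, `hwinQ1`, and `δ_Q`
  bound by `hδQ : δ_Q = …` to the companion's constant at `ι := ℓη` (the conclusion is I-13's, byte for byte).  Inside: `U ↔ V` in the companion (its first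
  family is I-13's `V`), both families at the common `α_j ≤ 1∕128`, `ε_j`; `‖V̄^j(b)Ū^j(b)⁻¹ − 1‖ ≤ δ_j` from `hLUV` + `hLbU`.
MODEL ∕ DECLARED READINGS.  Those of I-13 and of the companion.  On print's diagonal (`ηL^{n+1} = 1`, `c₁ = c₀L^{(n+1)d}`) `√(c₁∕(c₀L^{(n+1)d})) = 1`,
`L^{n+1}ℓη = ℓ` and `T̃ − 1 = O(max_j δ_j)·T̃` — the reader's arithmetic, not evaluated here.
HONEST SCOPE.  [folklore] one bundle re-assembled; ONE route sub-step's bookkeeping; after this file the N52 road (α) END displays, of the conjugated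
two-background letters, `δ_R` ALONE (plus (CDT)'s single-background letters at `U` and at `V` and the level profiles, as before); «NE9 ⇐ the named binders»; NE9
NOT PRINTED ∕ NOT PROVED; NOT summit progress (cell pub-balaban: row NE9 WALLED ON A MODEL (O-NE9-1; #5 UNRULED); spine PROVED 0∕9; rung (B)+1 finite T⁴ — NOT
infinite volume, NOT mass gap, NOT BetaPertH, NOT Clay; HONEST DEPENDENCY: continuum YM on T⁴ ⇐ BetaPertH ∧ nine spine estimates (0/9 proved); BetaPertH ⇐ (D1) ∧
(D4) ∧ CAP+tail; G-an2-4 gates asym, D1 and NE2/3/4).  NEW file; nothing modified.  Net new unproved facts: 0.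
-/

noncomputable section

open scoped InnerProductSpace ComplexConjugate BigOperators
open NormedSpace

namespace Literature.MathematicalPhysics.QuantumFieldTheory.Balaban1983to89.B9Eq326DeltaABlockDecayTowerTwoBackgroundsCurvQ

open B4Sect5Torus (TSite tdist)
open B9SectCLatticeCarrier (Bond bpos btgt)
open B9Eq311L2Pairing (WL2)
open B9Eq319QprimeTorus (blockCoord)
open B9Eq315QTower (towerP)
open B9Eq315QTorus (perCfg cornerSite)
open B7Prop1Explicit (Wcx boxVec)
open B9Eq316TowerFlatIsOneStep (siteCast siteCast_rfl towerP_eq_fineP_pow)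
open B7Prop1Explicit (U1)
open B11Eq103H1Complex (SiteL2K BondL2K covDivL2K)
open B9Eq310HessianOperator (adTransportW PlaqL2K curvOp)
open B9Eq310DeltaPrime (plaqHolU)
open B9Eq326OperatorTower (laplaceAk RofUk G1k QkW)
open B9Eq326DeltaABlockDecayTowerTwoBackgroundsCurv (norm_block_G1k_sub_G1k_le_lipschitz_curv)
open B9Eq349ConjugatedQTowerLettersTwoBackgroundsCompanion (expConj_Qk_letters_twoBackgrounds)

variable {d : ℕ} {L : ℕ} [NeZero L] {m : Fin d → ℕ} [∀ i, NeZero (m i)] {n : ℕ}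
  {𝔸 : Type*} [NormedRing 𝔸] [StarRing 𝔸] [NormedAlgebra ℂ 𝔸] [StarModule ℂ 𝔸] [CompleteSpace 𝔸] [NormOneClass 𝔸]
  {W : Type*} [NormedAddCommGroup W] [InnerProductSpace ℂ W] [FiniteDimensional ℂ W] (φ : W ≃ₗ[ℂ] 𝔸) {Mφ Mφ' : ℝ}
  (hφ : ∀ w, ‖φ w‖ ≤ Mφ * ‖w‖) (hφ' : ∀ X, ‖φ.symm X‖ ≤ Mφ' * ‖X‖) (hMφ : 0 ≤ Mφ) (hMφ' : 0 ≤ Mφ')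
  {c₀ : ℝ} [Fact (0 < c₀)] {c₁ : ℝ} [Fact (0 < c₁)] {η : ℝ} (hη : 0 < η) (hηL : η * (L : ℝ) ^ (n + 1) = 1)
  (U V : Bond d (towerP L m (n + 1)) → 𝔸ˣ) (hU : ∀ b, U b ∈ U1 𝔸) (hV : ∀ b, V b ∈ U1 𝔸)
  (hRSU : ∀ (b : Bond d (towerP L m (n + 1))) (v u : W), ⟪adTransportW φ U b v, u⟫_ℂ = ⟪v, adTransportW φ (fun b => (U b)⁻¹) b u⟫_ℂ)
  (hRSV : ∀ (b : Bond d (towerP L m (n + 1))) (v u : W), ⟪adTransportW φ V b v, u⟫_ℂ = ⟪v, adTransportW φ (fun b => (V b)⁻¹) b u⟫_ℂ)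
  (τ : 𝔸 →ₗ[ℂ] ℂ) (hL : 1 ≤ L) (α : ℕ → ℝ) (hα1 : ∀ j, α j ≤ 1 / 64)
  (hU1U : ∀ (j : ℕ) (x : B7Prop1Explicit.Site d) (κ : Fin d), perCfg (towerP L m (j + 1)) (B9Eq315QTower.UlevOf L m (n + 1) U j) x κ ∈ U1 𝔸)
  (hregU : ∀ (j : ℕ) (y : TSite d (towerP L m j)) (κ : Fin d) (r : Fin d → Fin L),
    ‖((Wcx L (perCfg (towerP L m (j + 1)) (B9Eq315QTower.UlevOf L m (n + 1) U j)) (cornerSite L y) κ (boxVec L r) : 𝔸ˣ) : 𝔸) - 1‖ ≤ α j)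
  (hU1V : ∀ (j : ℕ) (x : B7Prop1Explicit.Site d) (κ : Fin d), perCfg (towerP L m (j + 1)) (B9Eq315QTower.UlevOf L m (n + 1) V j) x κ ∈ U1 𝔸)
  (hregV : ∀ (j : ℕ) (y : TSite d (towerP L m j)) (κ : Fin d) (r : Fin d → Fin L),
    ‖((Wcx L (perCfg (towerP L m (j + 1)) (B9Eq315QTower.UlevOf L m (n + 1) V j)) (cornerSite L y) κ (boxVec L r) : 𝔸ˣ) : 𝔸) - 1‖ ≤ α j)
  (a : ℝ)

omit [StarRing 𝔸] [NormedAlgebra ℂ 𝔸] [StarModule ℂ 𝔸] [CompleteSpace 𝔸] in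
/-- for `v ∈ U1`: `‖uv⁻¹ − 1‖ ≤ ‖u − v‖` (`uv⁻¹ − 1 = (u − v)v⁻¹`). [folklore] [cite: Balaban1985BackgroundPropagators, p.390] -/
private theorem norm_mul_inv_sub_one_le {u v : 𝔸ˣ} (hv : v ∈ U1 𝔸) : ‖(u : 𝔸) * ((v⁻¹ : 𝔸ˣ) : 𝔸) - 1‖ ≤ ‖(u : 𝔸) - (v : 𝔸)‖ := by
  have e : (u : 𝔸) * ((v⁻¹ : 𝔸ˣ) : 𝔸) - 1 = ((u : 𝔸) - (v : 𝔸)) * ((v⁻¹ : 𝔸ˣ) : 𝔸) := by rw [sub_mul, Units.mul_inv]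
  rw [e]
  exact (norm_mul_le _ _).trans (mul_le_of_le_one_right (norm_nonneg _) (B7Prop1Explicit.mem_U1.1 hv).2)

include hφ hφ' hMφ hMφ' hη hηL hU hV hRSU hRSV in
/-- **THE BIG-BLOCK `L²` DECAY OF `G₁,k(V) − G₁,k(U)` WITH `e_R`, `e_Q`, `δ_K` AND THE CONJUGATED `Q_k` LETTERS DISCHARGED**: I-13's
`norm_block_G1k_sub_G1k_le_lipschitz_curv` with its two-background bundle cut to `δ_R` (`hTR`) and `δ_Q = M_φ′M_φ√(c₁∕(c₀L^{(n+1)d}))·P′_{n+1}(r)·(T̃_{n+1}(r) − 1)`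
(`hδQ`, the companion's constant at `ι := ℓη`) under the windows `r(3ℓ′ + L^{n+1}ℓη) ≤ 1`, `r·2dL^nℓη ≤ 1`. Displayed: (CDT)'s letters twice, `δ_R`. [folklore]
[cite: Balaban1985BackgroundPropagators, (3.26) p.395, (3.15)–(3.16) p.393, (3.49) p.399, (3.101) p.414, Thm 3.4 p.400, (3.86) p.407, Thm 3.11 p.416; Balaban1985Averaging, Proposition 7 p.43] -/
theorem norm_block_G1k_sub_G1k_le_lipschitz_curv_Q (ha : 0 ≤ a) (hm : ∀ i, 1 ≤ m i)
    (hposU : ∀ x : BondL2K ℂ d (towerP L m (n + 1)) c₀ W, x ≠ 0 → 0 < RCLike.re ⟪x, laplaceAk L m n φ η U hL α hα1 hU1U hregU τ (c₀ := c₀) (c₁ := c₁) a x⟫_ℂ)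
    (hposV : ∀ x : BondL2K ℂ d (towerP L m (n + 1)) c₀ W, x ≠ 0 → 0 < RCLike.re ⟪x, laplaceAk L m n φ η V hL α hα1 hU1V hregV τ (c₀ := c₀) (c₁ := c₁) a x⟫_ℂ)
    {γ β βK pK ℓ ℓ' r ρ CP : ℝ} (hγ : 0 < γ) (hβ : 0 ≤ β) (hℓ : 1 ≤ ℓ) (hℓ' : 1 ≤ ℓ') (hr : 0 ≤ r) (hρ : 0 ≤ ρ) (hρ8 : ρ ≤ 1 / 8)
    (hCP : 0 ≤ CP)
    (hcoerU : ∀ f : BondL2K ℂ d (towerP L m (n + 1)) c₀ W, γ * ‖f‖ ^ 2 ≤ RCLike.re ⟪f, laplaceAk L m n φ η U hL α hα1 hU1U hregU τ (c₀ := c₀) (c₁ := c₁) a f⟫_ℂ)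
    (hcoerV : ∀ f : BondL2K ℂ d (towerP L m (n + 1)) c₀ W, γ * ‖f‖ ^ 2 ≤ RCLike.re ⟪f, laplaceAk L m n φ η V hL α hα1 hU1V hregV τ (c₀ := c₀) (c₁ := c₁) a f⟫_ℂ)
    (hKreU : ∀ f : BondL2K ℂ d (towerP L m (n + 1)) c₀ W, -(pK * ‖f‖ ^ 2) ≤ RCLike.re ⟪f, curvOp φ τ η U f⟫_ℂ)
    (hKreV : ∀ f : BondL2K ℂ d (towerP L m (n + 1)) c₀ W, -(pK * ‖f‖ ^ 2) ≤ RCLike.re ⟪f, curvOp φ τ η V f⟫_ℂ)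
    (hwin : r * ℓ * η ≤ 1)
    (hβCC : 4 * r * ℓ * (Mφ * Mφ') * (d * Real.sqrt d) ≤ β) (hβC : 4 * r * ℓ * (Mφ * Mφ') * d ≤ β)
    (hβD : 2 * r * ℓ * (Mφ * Mφ') * Real.sqrt d ≤ β)
    (hQKU : ∀ (χ : TSite d (towerP L m (n + 1)) → ℝ) (χ' : TSite d m → ℝ),
      (∀ b : Bond d (towerP L m (n + 1)), |χ (bpos b) - χ (btgt b)| ≤ ℓ * η) →
      (∀ (y : TSite d m) (x : TSite d (towerP L m (n + 1))),
        siteCast (towerP_eq_fineP_pow L m (n + 1)) x ∈ B9Eq319QprimeTorus.blockOf (L ^ (n + 1)) m y → |χ' y - χ x| ≤ ℓ') →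
      ∀ (MB : BondL2K ℂ d (towerP L m (n + 1)) c₀ W →L[ℂ] BondL2K ℂ d (towerP L m (n + 1)) c₀ W),
      (∀ (g : BondL2K ℂ d (towerP L m (n + 1)) c₀ W) (b : Bond d (towerP L m (n + 1))),
        WL2.equiv ℂ (fun _ : Bond d (towerP L m (n + 1)) => c₀) W (MB g) b = (χ (bpos b) : ℂ) • WL2.equiv ℂ (fun _ : Bond d (towerP L m (n + 1)) => c₀) W g b) →
      ∀ (MS : SiteL2K ℂ d (towerP L m (n + 1)) c₀ W →L[ℂ] SiteL2K ℂ d (towerP L m (n + 1)) c₀ W),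
      (∀ (g : SiteL2K ℂ d (towerP L m (n + 1)) c₀ W) (x : TSite d (towerP L m (n + 1))),
        WL2.equiv ℂ (fun _ : TSite d (towerP L m (n + 1)) => c₀) W (MS g) x = (χ x : ℂ) • WL2.equiv ℂ (fun _ : TSite d (towerP L m (n + 1)) => c₀) W g x) →
      ∀ (MF : BondL2K ℂ d m c₁ W →L[ℂ] BondL2K ℂ d m c₁ W),
      (∀ (g : BondL2K ℂ d m c₁ W) (b' : Bond d m),
        WL2.equiv ℂ (fun _ : Bond d m => c₁) W (MF g) b' = (χ' (bpos b') : ℂ) • WL2.equiv ℂ (fun _ : Bond d m => c₁) W g b') →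
      ∀ κ : ℂ, ‖κ‖ = r →
      (∀ f, ‖exp (κ • MF) ((QkW L m n φ U hL α hα1 hU1U hregU (c₀ := c₀) (c₁ := c₁)) (exp (κ • (-MB)) f)) - (QkW L m n φ U hL α hα1 hU1U hregU (c₀ := c₀) (c₁ := c₁)) f‖ ≤ β * ‖f‖) ∧
      (∀ g, ‖exp (κ • MB) (LinearMap.adjoint (QkW L m n φ U hL α hα1 hU1U hregU (c₀ := c₀) (c₁ := c₁)) (exp (κ • (-MF)) g)) - LinearMap.adjoint (QkW L m n φ U hL α hα1 hU1U hregU (c₀ := c₀) (c₁ := c₁)) g‖ ≤ β * ‖g‖) ∧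
      (∀ f, ‖exp (κ • MB) (curvOp φ τ η U (exp (κ • (-MB)) f)) - curvOp φ τ η U f‖ ≤ βK * ‖f‖) ∧
      (∀ s, ‖exp (κ • MS) (RofUk L m n φ η U (c₀ := c₀) (exp (κ • (-MS)) s)) - RofUk L m n φ η U (c₀ := c₀) s‖ ≤ ρ * ‖s‖))
    (hQKV : ∀ (χ : TSite d (towerP L m (n + 1)) → ℝ) (χ' : TSite d m → ℝ),
      (∀ b : Bond d (towerP L m (n + 1)), |χ (bpos b) - χ (btgt b)| ≤ ℓ * η) →
      (∀ (y : TSite d m) (x : TSite d (towerP L m (n + 1))),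
        siteCast (towerP_eq_fineP_pow L m (n + 1)) x ∈ B9Eq319QprimeTorus.blockOf (L ^ (n + 1)) m y → |χ' y - χ x| ≤ ℓ') →
      ∀ (MB : BondL2K ℂ d (towerP L m (n + 1)) c₀ W →L[ℂ] BondL2K ℂ d (towerP L m (n + 1)) c₀ W),
      (∀ (g : BondL2K ℂ d (towerP L m (n + 1)) c₀ W) (b : Bond d (towerP L m (n + 1))),
        WL2.equiv ℂ (fun _ : Bond d (towerP L m (n + 1)) => c₀) W (MB g) b = (χ (bpos b) : ℂ) • WL2.equiv ℂ (fun _ : Bond d (towerP L m (n + 1)) => c₀) W g b) →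
      ∀ (MS : SiteL2K ℂ d (towerP L m (n + 1)) c₀ W →L[ℂ] SiteL2K ℂ d (towerP L m (n + 1)) c₀ W),
      (∀ (g : SiteL2K ℂ d (towerP L m (n + 1)) c₀ W) (x : TSite d (towerP L m (n + 1))),
        WL2.equiv ℂ (fun _ : TSite d (towerP L m (n + 1)) => c₀) W (MS g) x = (χ x : ℂ) • WL2.equiv ℂ (fun _ : TSite d (towerP L m (n + 1)) => c₀) W g x) →
      ∀ (MF : BondL2K ℂ d m c₁ W →L[ℂ] BondL2K ℂ d m c₁ W),
      (∀ (g : BondL2K ℂ d m c₁ W) (b' : Bond d m),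
        WL2.equiv ℂ (fun _ : Bond d m => c₁) W (MF g) b' = (χ' (bpos b') : ℂ) • WL2.equiv ℂ (fun _ : Bond d m => c₁) W g b') →
      ∀ κ : ℂ, ‖κ‖ = r →
      (∀ f, ‖exp (κ • MF) ((QkW L m n φ V hL α hα1 hU1V hregV (c₀ := c₀) (c₁ := c₁)) (exp (κ • (-MB)) f)) - (QkW L m n φ V hL α hα1 hU1V hregV (c₀ := c₀) (c₁ := c₁)) f‖ ≤ β * ‖f‖) ∧
      (∀ g, ‖exp (κ • MB) (LinearMap.adjoint (QkW L m n φ V hL α hα1 hU1V hregV (c₀ := c₀) (c₁ := c₁)) (exp (κ • (-MF)) g)) - LinearMap.adjoint (QkW L m n φ V hL α hα1 hU1V hregV (c₀ := c₀) (c₁ := c₁)) g‖ ≤ β * ‖g‖) ∧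
      (∀ f, ‖exp (κ • MB) (curvOp φ τ η V (exp (κ • (-MB)) f)) - curvOp φ τ η V f‖ ≤ βK * ‖f‖) ∧
      (∀ s, ‖exp (κ • MS) (RofUk L m n φ η V (c₀ := c₀) (exp (κ • (-MS)) s)) - RofUk L m n φ η V (c₀ := c₀) s‖ ≤ ρ * ‖s‖))
    (hPU : ∀ f, ‖covDivL2K ℂ c₀ ((η : ℂ))⁻¹ (adTransportW φ fun b => (U b)⁻¹) f - RofUk L m n φ η U (c₀ := c₀) (covDivL2K ℂ c₀ ((η : ℂ))⁻¹ (adTransportW φ fun b => (U b)⁻¹) f)‖ ≤ CP * ‖f‖)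
    (hPV : ∀ f, ‖covDivL2K ℂ c₀ ((η : ℂ))⁻¹ (adTransportW φ fun b => (V b)⁻¹) f - RofUk L m n φ η V (c₀ := c₀) (covDivL2K ℂ c₀ ((η : ℂ))⁻¹ (adTransportW φ fun b => (V b)⁻¹) f)‖ ≤ CP * ‖f‖)
    (small' : 3 / 4 * pK + (21 + 3 * a) * β ^ 2 + 4 * β * CP + 2 * ρ * CP ^ 2 + βK ≤ γ / 8)
    {δR : ℝ} (hδR : 0 ≤ δR)
    (hTR : ∀ (χ : TSite d (towerP L m (n + 1)) → ℝ) (χ' : TSite d m → ℝ),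
      (∀ b : Bond d (towerP L m (n + 1)), |χ (bpos b) - χ (btgt b)| ≤ ℓ * η) →
      (∀ (y : TSite d m) (x : TSite d (towerP L m (n + 1))),
        siteCast (towerP_eq_fineP_pow L m (n + 1)) x ∈ B9Eq319QprimeTorus.blockOf (L ^ (n + 1)) m y → |χ' y - χ x| ≤ ℓ') →
      ∀ (MB : BondL2K ℂ d (towerP L m (n + 1)) c₀ W →L[ℂ] BondL2K ℂ d (towerP L m (n + 1)) c₀ W),
      (∀ (g : BondL2K ℂ d (towerP L m (n + 1)) c₀ W) (b : Bond d (towerP L m (n + 1))),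
        WL2.equiv ℂ (fun _ : Bond d (towerP L m (n + 1)) => c₀) W (MB g) b = (χ (bpos b) : ℂ) • WL2.equiv ℂ (fun _ : Bond d (towerP L m (n + 1)) => c₀) W g b) →
      ∀ (MS : SiteL2K ℂ d (towerP L m (n + 1)) c₀ W →L[ℂ] SiteL2K ℂ d (towerP L m (n + 1)) c₀ W),
      (∀ (g : SiteL2K ℂ d (towerP L m (n + 1)) c₀ W) (x : TSite d (towerP L m (n + 1))),
        WL2.equiv ℂ (fun _ : TSite d (towerP L m (n + 1)) => c₀) W (MS g) x = (χ x : ℂ) • WL2.equiv ℂ (fun _ : TSite d (towerP L m (n + 1)) => c₀) W g x) →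
      ∀ (MF : BondL2K ℂ d m c₁ W →L[ℂ] BondL2K ℂ d m c₁ W),
      (∀ (g : BondL2K ℂ d m c₁ W) (b' : Bond d m),
        WL2.equiv ℂ (fun _ : Bond d m => c₁) W (MF g) b' = (χ' (bpos b') : ℂ) • WL2.equiv ℂ (fun _ : Bond d m => c₁) W g b') →
      ∀ κ : ℂ, ‖κ‖ = r →
      (∀ s, ‖exp (κ • MS) (RofUk L m n φ η V (c₀ := c₀) (exp (κ • (-MS)) s)) - exp (κ • MS) (RofUk L m n φ η U (c₀ := c₀) (exp (κ • (-MS)) s))‖ ≤ δR * ‖s‖))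
    -- the bond closeness of the two backgrounds, and the TREE's binders for the two Lipschitz letters `e_R`, `e_Q` (now DISCHARGED):
    {δ : ℝ} (hδ : 0 ≤ δ) (hUV : ∀ b, ‖(U b : 𝔸) - (V b : 𝔸)‖ ≤ δ * η)
    -- ne9-leaf-04 g81's binders for the conjugated `Δ′` letter (`B9Eq369CurvFormConjugationTwoBackgrounds` §4, two closeness letters): the involution
    -- and trace bounds, the plaquette window `ε` of `U`, the plaquette closeness `δ_p`
    (hstar : ∀ X : 𝔸, ‖star X‖ ≤ ‖X‖) {Cτ : ℝ} (hτ : ∀ X, ‖τ X‖ ≤ Cτ * ‖X‖) (hCτ : 0 ≤ Cτ)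
    {ε : ℝ} (hε : 0 ≤ ε) (hpl : ∀ p : B9SectCLatticeCarrier.Plaq d (towerP L m (n + 1)), ‖(plaqHolU U p : 𝔸) - 1‖ ≤ ε)
    {δp : ℝ} (hδp : 0 ≤ δp) (hpp : ∀ p : B9SectCLatticeCarrier.Plaq d (towerP L m (n + 1)), ‖(plaqHolU U p : 𝔸) - (plaqHolU V p : 𝔸)‖ ≤ δp)
    -- (3.16)'s weight relation, the bond smallness of both backgrounds, the common level profiles (`B9Eq325RLipschitzSqrtTowerTwoBackgroundsLinear`'s binders)
    (hw : c₀ * ((L : ℝ) ^ (n + 1)) ^ d = c₁) {a' : ℝ} (ha' : 0 < a') {αb : ℝ} (hαb : 0 ≤ αb)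
    (hUε : ∀ b, ‖(U b : 𝔸) - 1‖ ≤ αb * η) (hVε : ∀ b, ‖(V b : 𝔸) - 1‖ ≤ αb * η)
    (εU δUV : ℕ → ℝ) (hεU : ∀ j, 0 ≤ εU j) (hδUV : ∀ j, 0 ≤ δUV j)
    (hLεU : ∀ (j : ℕ) (b : Bond d (towerP L m (j + 1))), ‖(B9Eq315QTower.UlevOf L m (n + 1) U j b : 𝔸) - 1‖ ≤ εU j)
    (hLεV : ∀ (j : ℕ) (b : Bond d (towerP L m (j + 1))), ‖(B9Eq315QTower.UlevOf L m (n + 1) V j b : 𝔸) - 1‖ ≤ εU j)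
    (hLbU : ∀ (j : ℕ) (b : Bond d (towerP L m (j + 1))), B9Eq315QTower.UlevOf L m (n + 1) U j b ∈ U1 𝔸)
    (hLbV : ∀ (j : ℕ) (b : Bond d (towerP L m (j + 1))), B9Eq315QTower.UlevOf L m (n + 1) V j b ∈ U1 𝔸)
    (hLUV : ∀ (j : ℕ) (b : Bond d (towerP L m (j + 1))), ‖(B9Eq315QTower.UlevOf L m (n + 1) U j b : 𝔸) - (B9Eq315QTower.UlevOf L m (n + 1) V j b : 𝔸)‖ ≤ δUV j)
    {rp α₀ δ₀ : ℝ} (hrp0 : 0 ≤ rp) (hrp1 : rp < 1) (hαα₀ : αb ≤ α₀) (hδ₀ : 0 < δ₀)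
    (hεg : ∀ j < n + 1, εU j ≤ αb * rp ^ j) (hδg : ∀ j < n + 1, δUV j ≤ δ * rp ^ j)
    {sD sQ θb δbD γR θbG δbA sS sV s₂ sG₂ sA₂ : ℝ}
    (hsD : sD = Real.sqrt d * (2 * Mφ * Mφ'))
    (hsQ : sQ = 2 * (((d * (L - 1) : ℕ) : ℝ) * (2 * Mφ * Mφ') / (1 - rp)))
    (hθb : θb = sQ * α₀) (hδbD : δbD = sD * α₀)
    (hγRdef : γR = 1 / (2 + 2 / a') - (δbD + δbD ^ 2 + a' * θb * (2 * 1 + θb)))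
    (hθbG : θbG = 2 * δbD * (γR⁻¹ * (Real.sqrt γR)⁻¹) + (|a'| * θb * ((1 + θb) + 1)) * γR⁻¹ ^ 2)
    (hδbA : δbA = θbG * (1 + θb) + (2 + 2 / a') * θb)
    (hsS : sS = Real.sqrt (1 / (12 * (d : ℝ) * (6 / 5) ^ (d - 1) + a') ^ 2)) (hsV : sV = sS - δbA)
    (hs₂ : s₂ = 2 * Real.exp ((d * (L - 1) : ℕ) * (2 * Mφ * Mφ' * α₀ / (1 - rp))) *
      ((d * (L - 1) : ℕ) * (2 * Mφ * Mφ') * (1 + 2 * Mφ * Mφ' * α₀) ^ (d * (L - 1)) / (1 - rp)))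
    (hsG₂ : sG₂ = 2 * sD * (γR⁻¹ * (Real.sqrt γR)⁻¹) + (|a'| * s₂ * ((1 + θb) + (1 + θb))) * γR⁻¹ ^ 2)
    (hsA₂ : sA₂ = sG₂ * (1 + θb) + γR⁻¹ * s₂)
    (hc1 : ((d * (L - 1) : ℕ) : ℝ) * (2 * Mφ * Mφ') / (1 - rp) * α₀ ≤ 1) (hγR : 0 < γR) (hDγ : δbD ≤ 1 / (2 + 2 / a')) (hsV0 : 0 < sV)
    (hB : ((d * (L - 1) : ℕ) * (2 * Mφ * Mφ') * (1 + 2 * Mφ * Mφ' * α₀) ^ (d * (L - 1)) / (1 - rp)) * δ₀ ≤ 1) (hwinR : 2 * sA₂ * δ₀ ≤ sV)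
    -- `B9Eq315QTowerLipschitzL2TwoBackgroundsChain`'s extra binders (the `Q_k` letter)
    (hα128 : ∀ j, α j ≤ 1 / 128) (hδmax : ∀ j, δUV j ≤ 1 / (12288 * ((2 * (d * L) + L + L : ℕ) : ℝ)))
    (hwinQ : Real.sqrt ((L : ℝ) ^ d) * (Real.sqrt (2 * d) * (75497472 * ((d : ℝ) + 1) * ((2 * (d * L) + L + L : ℕ) : ℝ))) / (1 - rp) * δ ≤ 1)
    -- the two windows of the conjugated two-background `Q_k` letters (the companion's, at `ι := ℓη`) and their constant `δ_Q(r)` as a definitional binder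
    (hwinQ0 : r * (3 * ℓ' + (L : ℝ) ^ (n + 1) * (ℓ * η)) ≤ 1) (hwinQ1 : r * (2 * d * (L : ℝ) ^ n * (ℓ * η)) ≤ 1)
    {δQ : ℝ} (hδQ : δQ = Mφ' * Mφ * Real.sqrt (c₁ / (c₀ * ((L : ℝ) ^ (n + 1)) ^ d)) *
        ((∏ j ∈ Finset.range (n + 1), (1 + Real.sqrt ((L : ℝ) ^ d) * (Real.sqrt (2 * d) * (102 * (d + 1) ^ 2 * L * εU j) +
            2 * (r * (if j = 0 then 3 * ℓ' + (L : ℝ) ^ (n + 1) * (ℓ * η) else 2 * d * (L : ℝ) ^ (n + 1 - j) * (ℓ * η))) *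
              Real.sqrt (2 * (2 * d * (102 * (d + 1) ^ 2 * L * εU j) ^ 2 + ((L : ℝ) ^ d)⁻¹))))) *
          ((∏ j ∈ Finset.range (n + 1), (1 + Real.sqrt ((L : ℝ) ^ d) *
              ((1 + 2 * (r * (if j = 0 then 3 * ℓ' + (L : ℝ) ^ (n + 1) * (ℓ * η) else 2 * d * (L : ℝ) ^ (n + 1 - j) * (ℓ * η)))) * (2 * d) *
                (75497472 * ((d : ℝ) + 1) * ((2 * (d * L) + L + L : ℕ) : ℝ) * δUV j)))) - 1)))
    (PB : TSite d m → BondL2K ℂ d (towerP L m (n + 1)) c₀ W →L[ℂ] BondL2K ℂ d (towerP L m (n + 1)) c₀ W)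
    (hPB : ∀ (y : TSite d m) (f : BondL2K ℂ d (towerP L m (n + 1)) c₀ W) (b : Bond d (towerP L m (n + 1))),
      WL2.equiv ℂ (fun _ : Bond d (towerP L m (n + 1)) => c₀) W (PB y f) b =
        if blockCoord (L ^ (n + 1)) m (siteCast (towerP_eq_fineP_pow L m (n + 1)) (bpos b)) = y then
          WL2.equiv ℂ (fun _ : Bond d (towerP L m (n + 1)) => c₀) W f b else 0)
    (y₀ y₁ : TSite d m) :
    ‖PB y₁ ∘L (LinearMap.toContinuousLinearMap (G1k L m n φ η V hL α hα1 hU1V hregV τ (c₀ := c₀) (c₁ := c₁) hposV) - LinearMap.toContinuousLinearMap (G1k L m n φ η U hL α hα1 hU1U hregU τ (c₀ := c₀) (c₁ := c₁) hposU)) ∘L PB y₀‖ ≤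
      (((1 + β) * (4 * Real.exp (r * (ℓ * η)) * (Mφ * Mφ') * (d * Real.sqrt d) * δ) + (4 * Real.exp (r * (ℓ * η)) * (Mφ * Mφ') * (d * Real.sqrt d) * δ) * (1 + β) + (4 * Real.exp (r * (ℓ * η)) * (Mφ * Mφ') * (d * Real.sqrt d) * δ) * (4 * Real.exp (r * (ℓ * η)) * (Mφ * Mφ') * (d * Real.sqrt d) * δ)) +
          ((1 + CP + β) * ((1 + ρ) * (2 * Real.exp (r * (ℓ * η)) * (Mφ * Mφ') * Real.sqrt d * δ) + δR * (1 + CP + β)) + (2 * Real.exp (r * (ℓ * η)) * (Mφ * Mφ') * Real.sqrt d * δ) * ((1 + ρ) * (1 + CP + β)) +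
            (2 * Real.exp (r * (ℓ * η)) * (Mφ * Mφ') * Real.sqrt d * δ) * ((1 + ρ) * (2 * Real.exp (r * (ℓ * η)) * (Mφ * Mφ') * Real.sqrt d * δ) + δR * (1 + CP + β))) +
          (Real.exp (2 * (r * (ℓ * η))) * (16 * d * Cτ * Mφ ^ 2 * (|η| ^ d / c₀) * (‖((η : ℂ))⁻¹‖ ^ 2 * (12 * (δ * η) * ε + 3 * δp)))) + ((Real.sqrt a + |a| * β) * δQ + δQ * (Real.sqrt a + |a| * β) + |a| * (δQ * δQ))) / min (1 / 4) (γ / 8) *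
        ((1 + (8 * Real.sqrt d * (Mφ * Mφ') * δ + 2 * Mφ * Mφ' * δ * Real.sqrt d + (max (3 * sA₂ / sV) (2 / δ₀) * δ) * (1 + CP) + Real.sqrt a *
          (Mφ' * Mφ * Real.sqrt (c₁ / (c₀ * ((L : ℝ) ^ (n + 1)) ^ d)) * (2 * Real.exp (Real.sqrt ((L : ℝ) ^ d) * (Real.sqrt (2 * d) * (102 * (d + 1) ^ 2 * L)) * (αb / (1 - rp))) * (Real.sqrt ((L : ℝ) ^ d) * (Real.sqrt (2 * d) * (75497472 * ((d : ℝ) + 1) * ((2 * (d * L) + L + L : ℕ) : ℝ))) / (1 - rp) * δ))))) * (min (1 / 4) (γ / 8))⁻¹) * Real.exp r * Real.exp (-(r * tdist m y₀ y₁)) := by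
  -- the companion's constant is nonnegative (`1 ≤ T̃`)
  have hℓη : 0 ≤ ℓ * η := mul_nonneg (zero_le_one.trans hℓ) hη.le
  have hℓ'0 : 0 ≤ ℓ' := zero_le_one.trans hℓ'
  have hrd : ∀ j : ℕ, 0 ≤ (if j = 0 then 3 * ℓ' + (L : ℝ) ^ (n + 1) * (ℓ * η) else 2 * d * (L : ℝ) ^ (n + 1 - j) * (ℓ * η)) := fun j => by
    split_ifs <;> positivity
  have hδQ0 : 0 ≤ δQ := by
    rw [hδQ]
    refine mul_nonneg (by positivity) (mul_nonneg (Finset.prod_nonneg fun j _ => by have := hεU j; have := hrd j; positivity)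
      (sub_nonneg.2 (Finset.one_le_prod (s := Finset.range (n + 1)) fun j _ => ?_)))
    have := hδUV j; have := hrd j
    have h0 : 0 ≤ Real.sqrt ((L : ℝ) ^ d) *
        ((1 + 2 * (r * (if j = 0 then 3 * ℓ' + (L : ℝ) ^ (n + 1) * (ℓ * η) else 2 * d * (L : ℝ) ^ (n + 1 - j) * (ℓ * η)))) * (2 * d) *
          (75497472 * ((d : ℝ) + 1) * ((2 * (d * L) + L + L : ℕ) : ℝ) * δUV j)) := by positivity
    linarith
  -- the multiplicative closeness of the level averages from the additive one (`Ū^j(b) ∈ U1`)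
  have hVUδ : ∀ (j : ℕ) (b : Bond d (towerP L m (j + 1))),
      ‖(B9Eq315QTower.UlevOf L m (n + 1) V j b : 𝔸) * (((B9Eq315QTower.UlevOf L m (n + 1) U j b)⁻¹ : 𝔸ˣ) : 𝔸) - 1‖ ≤ δUV j := fun j b =>
    (norm_mul_inv_sub_one_le (hLbU j b)).trans (by rw [norm_sub_rev]; exact hLUV j b)
  refine norm_block_G1k_sub_G1k_le_lipschitz_curv φ hφ hφ' hMφ hMφ' hη hηL U V hU hV hRSU hRSV τ hL α hα1 hU1U hregU hU1V hregV a
    ha hm hposU hposV hγ hβ hℓ hℓ' hr hρ hρ8 hCP hcoerU hcoerV hKreU hKreV hwin hβCC hβC hβD hQKU hQKV hPU hPV small' hδR hδQ0 ?_ hδ hUV hstar hτ hCτ hε hpl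
    hδp hpp hw ha' hαb hUε hVε εU δUV hεU hδUV hLεU hLεV hLbU hLbV hLUV hrp0 hrp1 hαα₀ hδ₀ hεg hδg hsD hsQ hθb hδbD hγRdef hθbG hδbA hsS hsV hs₂ hsG₂ hsA₂ hc1
    hγR hDγ hsV0 hB hwinR hα128 hδmax hwinQ PB hPB y₀ y₁
  intro χ χ' hχ hχ' MB hMB MS hMS MF hMF κ hκr
  have tR := hTR χ χ' hχ hχ' MB hMB MS hMS MF hMF κ hκr
  obtain ⟨tQ, tQ'⟩ := expConj_Qk_letters_twoBackgrounds L m n hL hm φ hMφ hMφ' hφ hφ' (c₀ := c₀) (c₁ := c₁) V U α hα1 hU1V hregV α hα1 hU1U hregU hα128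
    εU hεU hLεV hLεU δUV hδUV hδmax hVUδ (ι := ℓ * η) hℓη hℓ'0 hχ hχ' hMB hMF hwinQ0 hwinQ1 κ hκr
  refine ⟨tR, fun f => ?_, fun g => ?_⟩
  · rw [hδQ]; exact tQ f
  · rw [hδQ]; exact tQ' g

end Literature.MathematicalPhysics.QuantumFieldTheory.Balaban1983to89.B9Eq326DeltaABlockDecayTowerTwoBackgroundsCurvQ

end
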